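import Summits.AtomisticToContinuum.HydrodynamicLimit.Theorems.OneFlightGossipEngineEnergyCurrentTailsFirstPartnerRung0Pathwise
import Summits.AtomisticToContinuum.HydrodynamicLimit.Theorems.OneFlightGossipEngineEnergyCurrentTailsFirstPartnerRung0Excess
import Summits.AtomisticToContinuum.HydrodynamicLimit.Theorems.OneFlightGossipEngineEnergyCurrentTailsFirstPartnerRung0MarkPositive
import Summits.AtomisticToContinuum.HydrodynamicLimit.Theorems.OneFlightGossipEngineEnergyCurrentTailsLevelCensusSplitFloorRung0TubeMean
import Summits.AtomisticToContinuum.HydrodynamicLimit.Theorems.JParityClosureOddContactSymmetryGibbsInvariance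
import Summits.AtomisticToContinuum.HydrodynamicLimit.Theorems.OneFlightGossipEngineEnergyCurrentTailsQuarticData
import Summits.AtomisticToContinuum.HydrodynamicLimit.Theorems.OneFlightGossipEngineEnergyCurrentTailsFirstPartnerObjects
import HarnessLib

/-!
# Crux `EnergyCurrentTails` (stmt-AtomisticToContinuum-9235), line `quartic-schur-ledger`:
# the RUNG-0 CERTIFICATE `stub_firstPartnerFloorRung0` of T′ `FirstPartnerFloorMeso`

The registered primitive T′ `stub_firstPartnerFloor` (`EnergyCurrentTailsFirstPartner.FirstPartnerFloorMeso`, objects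
file `…Theorems.OneFlightGossipEngineEnergyCurrentTailsFirstPartnerObjects`) at RUNG 0, i.e. for CONSTANT profiles
`(a, u, θ)`: under the homogeneous drifted Gibbs law `G_N` — invariant under every hard-sphere flow
(`map_flow_localGibbsLaw_const`, used through `lintegral_comp_flow_localGibbsLaw_const`) — the ‖v‖⁴-weighted lab-fast
spheres have, with probability `≥ c τ₁ σ²`, a thermal FIRST free-flight partner within the mesoscopic look-ahead
`Δ = τ₁ h_N`, `h_N = (N+1)^{-1/3}`, whose predicted encounter mixes.  With `K₀ = K₁ = 1`, `K₂ = 3`, `ε = ε_N = σ h_N`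
and the look-ahead ratio `κ = τ₁/σ` (so that the tube look-ahead `κ ε` IS `Δ`):
H1 `firstPartnerRung0_pathwise` (sure: band tube sum `≤ (N+1)·firstPartnerSum + 50·#{would-be pairs of out-degree
≥ 2}`); H2 `firstPartnerRung0_excess` (the latter count has a measurable majorant of Gibbs mean
`≤ 4096 (N+1)³ ε⁴ (κε)² (‖u‖² + 3θ) = 4096 (N+1) σ⁴ τ₁² (‖u‖² + 3θ)`); H3
`EnergyCurrentTailsLevelCensus.sum_pair_tubeMark_mean_ge_of_measurable` (tube mean
`≥ (N+1) N (1 − 16λ) ε³ κ Θ̄ = N σ² τ₁ (1 − 16λ) Θ̄`); H5 `firstPartnerRung0_markPositive` (`Θ̄ > 0`); the quartic side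
is `≤ Q = 8‖u‖⁴ + 8θ² K₄` uniformly in `N` (`lintegral_quarticSum_localGibbsLaw_le`).  Assembly: integrate H1 along
`Φ_r` (a.e. orbit is good, hence in the hard-sphere domain), transport the measurable pieces back to the static law by
invariance (`rung0_floor_window`), and close the arithmetic (`rung0_arith`, `ofReal_le_of_floor`) with
`τ₀ = (1 − 16λ)Θ̄ / (4 (204800 σ² (‖u‖² + 3θ) + 1))`, `c = (1 − 16λ)Θ̄ / (4 (Q + 1))`, `N ≥ 1` and `ε_N (1 + 10 κ) < 1/2`.

References: Gallagher–Saint-Raymond–Texier 2013 §4.1; Ruelle 1969 §4.2; Cercignani–Illner–Pulvirenti 1994 §2.2.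
-/

noncomputable section

open scoped BigOperators Classical ENNReal InnerProductSpace
open MeasureTheory Set Filter
open Literature.Analysis.FluidPDE Literature.MathematicalPhysics.KineticTheory
  Literature.MathematicalPhysics.StatisticalMechanics

namespace Summit.AtomisticToContinuum.HydrodynamicLimit.Theorems

namespace QuarticSchurLedger

open EnergyCurrentTailsFirstPartner RateFloorLine

/-- `ε_N = σ (N+1)^{-1/3} → 0`: eventually `hsDiameter σ N < δ` for every `δ > 0`. [folklore] -/
private theorem exists_hsDiameter_lt (σ : ℝ) {δ : ℝ} (hδ : 0 < δ) :
    ∃ N₀ : ℕ, ∀ N : ℕ, N₀ ≤ N → hsDiameter σ N < δ := by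
  have h : Tendsto (hsDiameter σ) atTop (nhds 0) := by
    have h3 : Tendsto (fun N : ℕ => ((N + 1 : ℕ) : ℝ)) atTop atTop :=
      tendsto_natCast_atTop_atTop.comp (tendsto_add_atTop_nat 1)
    have := ((tendsto_rpow_neg_atTop (by norm_num : (0 : ℝ) < 1 / 3)).comp h3).const_mul σ
    rw [mul_zero] at this
    exact this
  exact eventually_atTop.1 (h.eventually (gt_mem_nhds hδ))

/-- The chart hypothesis `ε_N (1 + 10κ) < 1/2` from `ε_N < 1 / (2 (1 + 10κ))`. [folklore] -/
private theorem chart_of_lt {ε κ : ℝ} (hκ : 0 < κ) (h : ε < 1 / (2 * (1 + 10 * κ))) : ε * (1 + 10 * κ) < 1 / 2 := by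
  have h10 : 0 < 1 + 10 * κ := by positivity
  rw [lt_div_iff₀ (by positivity)] at h
  nlinarith

/-- `(τ₁/σ) ε_N = τ₁ h_N`: the tube look-ahead of ratio `κ = τ₁/σ` is the line's look-ahead. [folklore] -/
private theorem div_mul_hsDiameter {σ : ℝ} (hσ : σ ≠ 0) (τ₁ : ℝ) (N : ℕ) :
    τ₁ / σ * hsDiameter σ N = τ₁ * ((N : ℝ) + 1) ^ (-(1 / 3 : ℝ)) := by
  rw [hsDiameter, Nat.cast_succ, ← mul_assoc, div_mul_cancel₀ τ₁ hσ]

/-- `σ² (N+1)^{1/3} · τ₁ h_N = σ² τ₁`. [folklore] -/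
private theorem clock_mul_lookAhead (c σ τ₁ : ℝ) (N : ℕ) :
    c * (σ ^ 2 * ((N + 1 : ℕ) : ℝ) ^ ((1 : ℝ) / 3)) * (τ₁ * ((N : ℝ) + 1) ^ (-(1 / 3 : ℝ))) = c * (σ ^ 2 * τ₁) := by
  have hpow : ((N + 1 : ℕ) : ℝ) ^ ((1 : ℝ) / 3) * ((N : ℝ) + 1) ^ (-(1 / 3 : ℝ)) = 1 := by
    rw [Nat.cast_succ, Real.rpow_neg (by positivity), mul_inv_cancel₀ (by positivity)]
  calc c * (σ ^ 2 * ((N + 1 : ℕ) : ℝ) ^ ((1 : ℝ) / 3)) * (τ₁ * ((N : ℝ) + 1) ^ (-(1 / 3 : ℝ)))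
      = c * (σ ^ 2 * τ₁) * (((N + 1 : ℕ) : ℝ) ^ ((1 : ℝ) / 3) * ((N : ℝ) + 1) ^ (-(1 / 3 : ℝ))) := by ring
    _ = c * (σ ^ 2 * τ₁) := by rw [hpow, mul_one]

/-- **The real arithmetic of the assembly.**  With `(N+1) ε³ = σ³`, `κ = τ₁/σ`, `c = λ'Θ̄/(4(Q+1))`,
`τ₁ ≤ τ₀ = λ'Θ̄/(4(204800 σ² m + 1))` (`m = ‖u‖² + 3θ`) and `N ≥ 1`:
`(N+1) c σ²τ₁ Q + 50 · 4096 (N+1)³ ε⁴ (κε)² m ≤ (N+1) N λ' ε³ κ Θ̄` (both error terms are `≤ (N+1) σ²τ₁ λ'Θ̄/4`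
and `(N+1)/2 ≤ N`). [folklore] -/
private theorem rung0_arith {σ τ₁ τ₀ κ lam Θ Q c ε θb : ℝ} {N : ℕ} (u : V3) (hθ : 0 < θb) (hσ : 0 < σ)
    (hτ₁ : 0 < τ₁) (hN1 : (1 : ℝ) ≤ N) (hε3 : ((N + 1 : ℕ) : ℝ) * ε ^ 3 = σ ^ 3) (hκ : κ = τ₁ / σ)
    (hlam : 0 < lam) (hΘ : 0 < Θ) (hQ : 0 ≤ Q) (hc : c = lam * Θ / (4 * (Q + 1)))
    (hτ₀ : τ₀ = lam * Θ / (4 * (204800 * σ ^ 2 * (‖u‖ ^ 2 + 3 * θb) + 1))) (hτ₁le : τ₁ ≤ τ₀) :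
    0 ≤ c * (σ ^ 2 * τ₁) * Q ∧
      0 ≤ 50 * (4096 * (((N + 1 : ℕ) : ℝ) ^ 3 * (ε ^ 4 * (κ * ε) ^ 2 * (‖u‖ ^ 2 + 3 * θb)))) ∧
      ((N + 1 : ℕ) : ℝ) * (c * (σ ^ 2 * τ₁) * Q) +
          50 * (4096 * (((N + 1 : ℕ) : ℝ) ^ 3 * (ε ^ 4 * (κ * ε) ^ 2 * (‖u‖ ^ 2 + 3 * θb)))) ≤
        ((N + 1 : ℕ) : ℝ) * N * (lam * ε ^ 3 * κ * Θ) := by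
  set m : ℝ := ‖u‖ ^ 2 + 3 * θb with hm
  have hm0 : 0 < m := by positivity
  set n : ℝ := ((N + 1 : ℕ) : ℝ) with hn
  have hn1 : n = N + 1 := by rw [hn]; push_cast; ring
  have hc0 : 0 < c := by rw [hc]; positivity
  have hτ₀0 : 0 < τ₀ := by rw [hτ₀]; positivity
  have hκ0 : 0 < κ := by rw [hκ]; positivity
  have hσκ : σ * κ = τ₁ := by rw [hκ, mul_div_assoc', mul_div_cancel_left₀ τ₁ hσ.ne']
  refine ⟨by positivity, by positivity, ?_⟩
  -- the two identities `(N+1) N ε³ κ = N σ² τ₁`, `(N+1)³ ε⁶ κ² = (N+1) σ⁴ τ₁²`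
  have eR : n * N * (lam * ε ^ 3 * κ * Θ) = N * (σ ^ 2 * τ₁) * (lam * Θ) := by
    rw [← hσκ]; linear_combination (N * κ * (lam * Θ)) * hε3
  have eE : 50 * (4096 * (n ^ 3 * (ε ^ 4 * (κ * ε) ^ 2 * m))) = 204800 * n * (σ ^ 2 * τ₁) * (σ ^ 2 * τ₁) * m := by
    rw [← hσκ]; linear_combination (204800 * n * κ ^ 2 * m * (n * ε ^ 3 + σ ^ 3)) * hε3
  rw [eR, eE]
  -- the two quarter bounds `c Q ≤ λ'Θ̄/4`, `204800 σ² τ₁ m ≤ λ'Θ̄/4`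
  have hcQ : c * Q ≤ lam * Θ / 4 := by
    have h2 : c * (Q + 1) = lam * Θ / 4 := by
      rw [hc, div_mul_eq_mul_div, mul_div_mul_right _ _ (by positivity : (Q + 1 : ℝ) ≠ 0)]
    nlinarith
  have hτm : 204800 * (σ ^ 2 * τ₁) * m ≤ lam * Θ / 4 := by
    have hA : 0 ≤ 204800 * σ ^ 2 * m := by positivity
    have h2 : τ₀ * (204800 * σ ^ 2 * m + 1) = lam * Θ / 4 := by
      rw [hτ₀, div_mul_eq_mul_div, mul_div_mul_right _ _ (by positivity : (204800 * σ ^ 2 * m + 1 : ℝ) ≠ 0)]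
    nlinarith [mul_le_mul_of_nonneg_left hτ₁le hA, hτ₀0.le]
  have hhalf : n / 2 ≤ N := by rw [hn1]; linarith
  have hst : 0 ≤ σ ^ 2 * τ₁ := by positivity
  have hlΘ : 0 ≤ lam * Θ := by positivity
  calc n * (c * (σ ^ 2 * τ₁) * Q) + 204800 * n * (σ ^ 2 * τ₁) * (σ ^ 2 * τ₁) * m
      = (σ ^ 2 * τ₁) * n * (c * Q + 204800 * (σ ^ 2 * τ₁) * m) := by ring
    _ ≤ (σ ^ 2 * τ₁) * n * (lam * Θ / 4 + lam * Θ / 4) := by gcongr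
    _ = (σ ^ 2 * τ₁) * (lam * Θ) * (n / 2) := by ring
    _ ≤ (σ ^ 2 * τ₁) * (lam * Θ) * N := by gcongr
    _ = N * (σ ^ 2 * τ₁) * (lam * Θ) := by ring

/-- **Cancellation in `ℝ≥0∞`**: from `ofReal A ≤ n X + ofReal E` and `n B + E ≤ A` (`B, E ≥ 0`, `n ≠ 0`) conclude
`ofReal B ≤ X` (no subtraction in `ℝ≥0∞`). [folklore] -/
private theorem ofReal_le_of_floor {A B E : ℝ} {n : ℕ} {X : ℝ≥0∞} (hn : n ≠ 0) (hB : 0 ≤ B) (hE : 0 ≤ E)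
    (hkey : ENNReal.ofReal A ≤ (n : ℝ≥0∞) * X + ENNReal.ofReal E) (hreal : (n : ℝ) * B + E ≤ A) :
    ENNReal.ofReal B ≤ X := by
  have h1 : (n : ℝ≥0∞) * ENNReal.ofReal B + ENNReal.ofReal E ≤ (n : ℝ≥0∞) * X + ENNReal.ofReal E :=
    calc (n : ℝ≥0∞) * ENNReal.ofReal B + ENNReal.ofReal E = ENNReal.ofReal ((n : ℝ) * B + E) := by
          rw [← ENNReal.ofReal_natCast, ← ENNReal.ofReal_mul (Nat.cast_nonneg _),
            ← ENNReal.ofReal_add (mul_nonneg (Nat.cast_nonneg _) hB) hE]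
      _ ≤ ENNReal.ofReal A := ENNReal.ofReal_le_ofReal hreal
      _ ≤ _ := hkey
  have h2 := ENNReal.le_of_add_le_add_right ENNReal.ofReal_ne_top h1
  exact (ENNReal.mul_le_mul_iff_right (by exact_mod_cast hn) (ENNReal.natCast_ne_top _)).1 h2

/-- `t ≤ n f + C k` and `k ≤ M` give `ofReal t ≤ n · ofReal f + ofReal C · M` in `ℝ≥0∞` (`C ≥ 0`). [folklore] -/
private theorem ofReal_le_of_le_add_mul_card {t f C : ℝ} {n k : ℕ} {M : ℝ≥0∞} (hC : 0 ≤ C)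
    (h : t ≤ (n : ℝ) * f + C * (k : ℝ)) (hk : (k : ℝ≥0∞) ≤ M) :
    ENNReal.ofReal t ≤ (n : ℝ≥0∞) * ENNReal.ofReal f + ENNReal.ofReal C * M :=
  calc ENNReal.ofReal t ≤ ENNReal.ofReal ((n : ℝ) * f + C * (k : ℝ)) := ENNReal.ofReal_le_ofReal h
    _ ≤ ENNReal.ofReal ((n : ℝ) * f) + ENNReal.ofReal (C * (k : ℝ)) := ENNReal.ofReal_add_le
    _ = (n : ℝ≥0∞) * ENNReal.ofReal f + ENNReal.ofReal C * (k : ℝ≥0∞) := by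
        rw [ENNReal.ofReal_mul (Nat.cast_nonneg _), ENNReal.ofReal_natCast, ENNReal.ofReal_mul hC,
          ENNReal.ofReal_natCast]
    _ ≤ _ := add_le_add le_rfl (mul_le_mul_right hk _)

/-! ## The quartic side -/

/-- The cut-off empirical quartic moment is measurable. [folklore] -/
private theorem measurable_fastQuarticAvg (N : ℕ) (K₀ : ℝ) : Measurable (fastQuarticAvg N K₀) := by
  unfold fastQuarticAvg
  refine Measurable.const_mul (Finset.measurable_sum _ fun i _ => ?_) _
  have h : Measurable fun y : Config (N + 1) (Fin 3) T3 => ‖(y i).2‖ := (measurable_pi_apply i).snd.norm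
  exact Measurable.ite (measurableSet_lt measurable_const h) (h.pow_const 4) measurable_const

/-- `fastQuarticAvg ≤ (N+1)⁻¹ Σᵢ ‖vᵢ‖⁴`. [folklore] -/
private theorem fastQuarticAvg_le (N : ℕ) (K₀ : ℝ) (y : Config (N + 1) (Fin 3) T3) :
    fastQuarticAvg N K₀ y ≤ ((N + 1 : ℕ) : ℝ)⁻¹ * ∑ i : Fin (N + 1), ‖(y i).2‖ ^ 4 := by
  unfold fastQuarticAvg
  refine mul_le_mul_of_nonneg_left (Finset.sum_le_sum fun i _ => ?_) (inv_nonneg.2 (Nat.cast_nonneg _))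
  split_ifs
  · exact le_rfl
  · positivity

/-- **N-uniform quartic content at rung 0, along the flow**: by invariance of `G_N` and the Gaussian quartic moment,
`E_{G_N}[fastQuarticAvg N K₀ ∘ Φ_r] ≤ 8‖u‖⁴ + 8θ² K₄`. [folklore] -/
private theorem lintegral_fastQuarticAvg_flow_le {σ a θ : ℝ} (hσ2 : σ ≤ 1 / 2) (ha : 0 < a) (hθ : 0 < θ) (u : V3)
    (N : ℕ) (Φ : HardSphereFlow (Torus.geometry (Fin 3)) (hsDiameter σ N) (N + 1)) (K₀ r : ℝ) :
    ∫⁻ z, ENNReal.ofReal (fastQuarticAvg N K₀ (Φ.flow r z)) ∂(localGibbsLaw σ (fun _ => a) (fun _ => u) (fun _ => θ) N Φ) ≤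
      ENNReal.ofReal (8 * ‖u‖ ^ 4 + 8 * θ ^ 2 * ∫ w, ‖w‖ ^ 4 ∂ProbabilityTheory.stdGaussian V3) := by
  have hsum := lintegral_quarticSum_localGibbsLaw_le (a₀ := fun _ => a) (θ₀ := fun _ => θ) (u₀ := fun _ => u)
    continuous_const continuous_const continuous_const (fun _ => ha) (fun _ => hθ) (U := ‖u‖) (θM := θ)
    (fun _ => le_rfl) (fun _ => le_rfl) hσ2 N Φ
  have hmeasSum : Measurable fun z : Config (N + 1) (Fin 3) T3 => ENNReal.ofReal (∑ i, ‖(z i).2‖ ^ 4) :=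
    (Finset.measurable_sum _ fun i _ => (measurable_pi_apply i).snd.norm.pow_const 4).ennreal_ofReal
  have hc : (0 : ℝ) ≤ ((N + 1 : ℕ) : ℝ)⁻¹ := inv_nonneg.2 (Nat.cast_nonneg _)
  have hN : ((N + 1 : ℕ) : ℝ) ≠ 0 := by positivity
  rw [lintegral_comp_flow_localGibbsLaw_const σ a θ u N Φ r (measurable_fastQuarticAvg N K₀).ennreal_ofReal]
  calc ∫⁻ y, ENNReal.ofReal (fastQuarticAvg N K₀ y) ∂(localGibbsLaw σ (fun _ => a) (fun _ => u) (fun _ => θ) N Φ)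
      ≤ ∫⁻ y, ENNReal.ofReal ((N + 1 : ℕ) : ℝ)⁻¹ * ENNReal.ofReal (∑ i, ‖(y i).2‖ ^ 4)
          ∂(localGibbsLaw σ (fun _ => a) (fun _ => u) (fun _ => θ) N Φ) := by
        refine lintegral_mono fun y => ?_
        rw [← ENNReal.ofReal_mul hc]
        exact ENNReal.ofReal_le_ofReal (fastQuarticAvg_le N K₀ y)
    _ = ENNReal.ofReal ((N + 1 : ℕ) : ℝ)⁻¹ * ∫⁻ y, ENNReal.ofReal (∑ i, ‖(y i).2‖ ^ 4)
          ∂(localGibbsLaw σ (fun _ => a) (fun _ => u) (fun _ => θ) N Φ) := lintegral_const_mul _ hmeasSum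
    _ ≤ ENNReal.ofReal ((N + 1 : ℕ) : ℝ)⁻¹ * ENNReal.ofReal (((N : ℝ) + 1) *
          (8 * ‖u‖ ^ 4 + 8 * θ ^ 2 * ∫ w, ‖w‖ ^ 4 ∂ProbabilityTheory.stdGaussian V3)) :=
        mul_le_mul_right hsum _
    _ = _ := by
        rw [← ENNReal.ofReal_mul hc, ← Nat.cast_succ, inv_mul_cancel_left₀ hN]

/-! ## The static floor integrated along the flow -/

/-- **One look-ahead window at rung 0.**  For constant profiles, small density, a flow `Φ`, a time `r`, a look-ahead
ratio `κ > 0` with `κ ε_N = Δ` and the chart hypothesis `ε_N (1 + 10κ) < 1/2`: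
`(N+1) N (1 − 16λ) ε_N³ κ Θ̄ ≤ (N+1) · E_{G_N}[firstPartnerSum(Δ) ∘ Φ_r] + 50 · 4096 (N+1)³ ε_N⁴ (κε_N)² (‖u‖² + 3θ)`
(H3 ≤ static tube mean = tube mean along `Φ_r` by invariance ≤ H1 integrated, the excess by H2). [folklore] -/
private theorem rung0_floor_window {σ a θb : ℝ} (hσ : 0 < σ) (hsd : SmallDensity uniformProfile σ) (ha : 0 < a)
    (hθ : 0 < θb) (u : V3) (N : ℕ) (Φ : HardSphereFlow (Torus.geometry (Fin 3)) (hsDiameter σ N) (N + 1)) (r : ℝ)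
    {κ Δ : ℝ} (hκ : 0 < κ) (hκε : κ * hsDiameter σ N = Δ) (hchart : hsDiameter σ N * (1 + 10 * κ) < 1 / 2) :
    ENNReal.ofReal (((N + 1 : ℕ) : ℝ) * N * ((1 - 16 * ovDensity uniformProfile σ) * hsDiameter σ N ^ 3 * κ *
        ∫ p : V3 × V3, sphereMark (fun q : V3 × V3 × V3 => if 1 < ‖q.2.1‖ ∧ ‖q.2.1‖ ≤ 3 ∧ ‖q.2.2‖ ≤ 1 then
          2 * (‖(reflectVel q.1 (q.2.1, q.2.2)).1‖ ^ 2 * ‖(reflectVel q.1 (q.2.1, q.2.2)).2‖ ^ 2) else 0) p.1 p.2 *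
          (localMaxwellian 1 θb u p.1 * localMaxwellian 1 θb u p.2))) ≤
      ((N + 1 : ℕ) : ℝ≥0∞) * (∫⁻ z, ENNReal.ofReal (firstPartnerSum (hsDiameter σ N) Δ (Φ.flow r z) r (mixMark N 1 1))
          ∂(localGibbsLaw σ (fun _ => a) (fun _ => u) (fun _ => θb) N Φ)) +
        ENNReal.ofReal (50 * (4096 * (((N + 1 : ℕ) : ℝ) ^ 3 *
          (hsDiameter σ N ^ 4 * (κ * hsDiameter σ N) ^ 2 * (‖u‖ ^ 2 + 3 * θb))))) := by
  have hσ2 : σ < 1 / 2 := hsd.σ_lt_half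
  have hε : 0 < hsDiameter σ N := hsDiameter_pos hσ N
  have hchart1 : hsDiameter σ N * (1 + 2 * κ * (1 + 3 + 1)) < 1 / 2 := by
    have : hsDiameter σ N * (1 + 2 * κ * (1 + 3 + 1)) = hsDiameter σ N * (1 + 10 * κ) := by ring
    rw [this]; exact hchart
  have hsmallT : hsDiameter σ N * (1 + 2 * (5 / 2) * κ) < 1 / 2 := by
    have : hsDiameter σ N * (1 + 2 * (5 / 2) * κ) ≤ hsDiameter σ N * (1 + 10 * κ) := by nlinarith [mul_pos hε hκ]
    exact this.trans_lt hchart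
  -- the band mixing mark `Ξ` (K₀ = K₁ = 1, K₂ = 3): measurable, `0 ≤ Ξ ≤ 50`, speed cutoff `5`
  set Ξ : V3 × V3 × V3 → ℝ := fun q : V3 × V3 × V3 => if 1 < ‖q.2.1‖ ∧ ‖q.2.1‖ ≤ 3 ∧ ‖q.2.2‖ ≤ 1 then
    2 * (‖(reflectVel q.1 (q.2.1, q.2.2)).1‖ ^ 2 * ‖(reflectVel q.1 (q.2.1, q.2.2)).2‖ ^ 2) else 0 with hΞdef
  have hΞm : Measurable Ξ := by
    refine Measurable.ite ?_ ?_ measurable_const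
    · have h1 : Measurable fun q : V3 × V3 × V3 => ‖q.2.1‖ := by fun_prop
      have h2 : Measurable fun q : V3 × V3 × V3 => ‖q.2.2‖ := by fun_prop
      exact (measurableSet_lt measurable_const h1).inter
        ((measurableSet_le h1 measurable_const).inter (measurableSet_le h2 measurable_const))
    · simp only [reflectVel]
      fun_prop
  have hΞ0 : ∀ p, 0 ≤ Ξ p := fun p => by
    simp only [hΞdef]
    split_ifs
    · positivity
    · exact le_rfl
  have hΞC : ∀ p, Ξ p ≤ 50 := fun p => by
    simp only [hΞdef]
    split_ifs with h
    · obtain ⟨-, h2, h3⟩ := h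
      have he := norm_sq_reflectVel_fst_add_norm_sq_reflectVel_snd p.1 (p.2.1, p.2.2)
      dsimp only at he
      set x := ‖(reflectVel p.1 (p.2.1, p.2.2)).1‖ ^ 2
      set y := ‖(reflectVel p.1 (p.2.1, p.2.2)).2‖ ^ 2
      have hv : ‖p.2.1‖ ^ 2 ≤ 3 ^ 2 := pow_le_pow_left₀ (norm_nonneg _) h2 2
      have hw : ‖p.2.2‖ ^ 2 ≤ 1 ^ 2 := pow_le_pow_left₀ (norm_nonneg _) h3 2
      have hxy : x + y ≤ 10 := by rw [he]; linarith
      have hxy0 : 0 ≤ x + y := by positivity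
      nlinarith [sq_nonneg (x - y), mul_le_mul hxy hxy hxy0 (by norm_num : (0 : ℝ) ≤ 10)]
    · norm_num
  have hΞabs : ∀ p, |Ξ p| ≤ 50 := fun p => by rw [abs_of_nonneg (hΞ0 p)]; exact hΞC p
  have hΞL : ∀ m v v' : V3, 2 * (5 / 2 : ℝ) ≤ ‖v - v'‖ → Ξ (m, v, v') = 0 := fun m v v' h => by
    simp only [hΞdef]
    rw [if_neg]
    rintro ⟨-, h2, h3⟩
    have := norm_sub_le v v'
    linarith
  -- the law
  set G := localGibbsLaw σ (fun _ => a) (fun _ => u) (fun _ => θb) N Φ with hGdef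
  haveI : IsProbabilityMeasure G := isProbabilityMeasure_localGibbsLaw continuous_const continuous_const
    continuous_const (fun _ => ha) (fun _ => hθ) hσ2.le N Φ
  -- the static tube sum and its measurability / integrability
  set tube : Config (N + 1) (Fin 3) T3 → ℝ := fun w => ∑ i : Fin (N + 1), ∑ j : Fin (N + 1),
    (if i ≠ j then pairTubeMark (hsDiameter σ N) κ Ξ i j (fun m => (w m).1) (fun m => (w m).2) else 0) with htube
  have htubem : Measurable tube := by
    refine Finset.measurable_sum _ fun i _ => Finset.measurable_sum _ fun j _ => ?_
    by_cases hij : i ≠ j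
    · simp only [if_pos hij]; exact measurable_pairTubeMark_config (hsDiameter σ N) κ hΞm i j
    · simp only [if_neg hij]; exact measurable_const
  have hptm0 : ∀ (i j : Fin (N + 1)) (x : Fin (N + 1) → T3) (v : Fin (N + 1) → V3),
      0 ≤ pairTubeMark (hsDiameter σ N) κ Ξ i j x v := fun i j x v => by
    unfold pairTubeMark tubeMark; split_ifs <;> [exact hΞ0 _; exact le_rfl]
  have htube0 : ∀ w, 0 ≤ tube w := fun w => Finset.sum_nonneg fun i _ => Finset.sum_nonneg fun j _ => by
    split_ifs <;> [exact hptm0 _ _ _ _; exact le_rfl]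
  have htubeb : ∀ w, ‖tube w‖ ≤ ((N + 1 : ℕ) : ℝ) * (((N + 1 : ℕ) : ℝ) * 50) := fun w => by
    rw [Real.norm_eq_abs, abs_of_nonneg (htube0 w), htube]
    calc (∑ i : Fin (N + 1), ∑ j : Fin (N + 1),
          (if i ≠ j then pairTubeMark (hsDiameter σ N) κ Ξ i j (fun m => (w m).1) (fun m => (w m).2) else 0))
        ≤ ∑ _i : Fin (N + 1), ∑ _j : Fin (N + 1), (50 : ℝ) :=
          Finset.sum_le_sum fun i _ => Finset.sum_le_sum fun j _ => by
            split_ifs <;> [exact (le_abs_self _).trans (abs_pairTubeMark_le _ _ hΞabs i j _ _); norm_num]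
      _ = ((N + 1 : ℕ) : ℝ) * (((N + 1 : ℕ) : ℝ) * 50) := by
          simp only [Finset.sum_const, Finset.card_univ, Fintype.card_fin, nsmul_eq_mul]
  have htubei : Integrable tube G := Integrable.of_bound htubem.aestronglyMeasurable _ (ae_of_all _ htubeb)
  -- H2: the measurable majorant of the out-degree-≥-2 count (look-ahead `κ ε = Δ`)
  obtain ⟨M, hMm, hMD, hMI⟩ := firstPartnerRung0_excess σ hσ hσ2.le hsd a θb ha hθ u N Φ
    (κ * hsDiameter σ N) (mul_pos hκ hε)
  have hMf : Measurable fun z => M (Φ.flow r z) := hMm.comp (Φ.measurable_flow r)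
  -- H1 along `Φ_r`, a.e. (a.e. orbit is good, hence in the hard-sphere domain)
  have h50 : ((3 : ℝ) ^ 2 + 1 ^ 2) ^ 2 / 2 = 50 := by norm_num
  have hae : ∀ᵐ z ∂G, ENNReal.ofReal (tube (Φ.flow r z)) ≤
      ((N + 1 : ℕ) : ℝ≥0∞) * ENNReal.ofReal (firstPartnerSum (hsDiameter σ N) Δ (Φ.flow r z) r (mixMark N 1 1)) +
        ENNReal.ofReal 50 * M (Φ.flow r z) := by
    filter_upwards [ae_mem_good_localGibbsLaw σ (fun _ => a) (fun _ => u) (fun _ => θb) N Φ] with z hz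
    have hP := firstPartnerRung0_pathwise N (hsDiameter σ N) κ Δ 1 1 3 r hε hκ.le hκε.le zero_le_one
      (by norm_num) hchart1 (Φ.flow r z)
    rw [h50] at hP
    exact ofReal_le_of_le_add_mul_card (by norm_num) hP (hMD _ (Φ.good_subset (Φ.mapsTo_good r hz)))
  -- H3: the tube mean (χ ≡ 1)
  have hT := EnergyCurrentTailsLevelCensus.sum_pair_tubeMark_mean_ge_of_measurable (u := u) Φ hsd ha hθ
    (χ := fun _ => (1 : ℝ)) continuous_const (fun _ => zero_le_one) hΞm hΞabs hΞ0 (L := 5 / 2) (κ := κ)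
    (by norm_num) hκ.le hΞL hsmallT
  simp only [one_mul, integral_const, smul_eq_mul, mul_one, probReal_univ] at hT
  have hmain : ((N + 1 : ℕ) : ℝ) * N * ((1 - 16 * ovDensity uniformProfile σ) * hsDiameter σ N ^ 3 * κ *
      ∫ p : V3 × V3, sphereMark Ξ p.1 p.2 * (localMaxwellian 1 θb u p.1 * localMaxwellian 1 θb u p.2)) ≤
      ∫ w, tube w ∂G := by
    simpa only [htube] using hT
  -- integrate along `Φ_r` and transport the measurable pieces back by invariance
  calc _ ≤ ENNReal.ofReal (∫ w, tube w ∂G) := ENNReal.ofReal_le_ofReal hmain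
    _ = ∫⁻ w, ENNReal.ofReal (tube w) ∂G := ofReal_integral_eq_lintegral_ofReal htubei (ae_of_all _ htube0)
    _ = ∫⁻ z, ENNReal.ofReal (tube (Φ.flow r z)) ∂G :=
        (lintegral_comp_flow_localGibbsLaw_const σ a θb u N Φ r (g := fun w => ENNReal.ofReal (tube w))
          htubem.ennreal_ofReal).symm
    _ ≤ ∫⁻ z, (((N + 1 : ℕ) : ℝ≥0∞) * ENNReal.ofReal (firstPartnerSum (hsDiameter σ N) Δ (Φ.flow r z) r
          (mixMark N 1 1)) + ENNReal.ofReal 50 * M (Φ.flow r z)) ∂G := lintegral_mono_ae hae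
    _ = ((N + 1 : ℕ) : ℝ≥0∞) * (∫⁻ z, ENNReal.ofReal (firstPartnerSum (hsDiameter σ N) Δ (Φ.flow r z) r
          (mixMark N 1 1)) ∂G) + ENNReal.ofReal 50 * ∫⁻ z, M (Φ.flow r z) ∂G := by
        rw [lintegral_add_right _ (hMf.const_mul _), lintegral_const_mul' _ _ (ENNReal.natCast_ne_top _),
          lintegral_const_mul _ hMf]
    _ = ((N + 1 : ℕ) : ℝ≥0∞) * (∫⁻ z, ENNReal.ofReal (firstPartnerSum (hsDiameter σ N) Δ (Φ.flow r z) r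
          (mixMark N 1 1)) ∂G) + ENNReal.ofReal 50 * ∫⁻ w, M w ∂G := by
        rw [lintegral_comp_flow_localGibbsLaw_const σ a θb u N Φ r hMm]
    _ ≤ ((N + 1 : ℕ) : ℝ≥0∞) * (∫⁻ z, ENNReal.ofReal (firstPartnerSum (hsDiameter σ N) Δ (Φ.flow r z) r
          (mixMark N 1 1)) ∂G) + ENNReal.ofReal 50 * ENNReal.ofReal (4096 * (((N + 1 : ℕ) : ℝ) ^ 3 *
            (hsDiameter σ N ^ 4 * (κ * hsDiameter σ N) ^ 2 * (‖u‖ ^ 2 + 3 * θb)))) := by gcongr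
    _ = _ := by rw [← ENNReal.ofReal_mul (by norm_num)]

/-! ## The registered stub -/

/-- **Registered stub `stub_firstPartnerFloorRung0` — RUNG 0 of T′ `FirstPartnerFloorMeso`** (line
`quartic-schur-ledger`, crux `EnergyCurrentTails`, stmt-AtomisticToContinuum-9235): for constant profiles `a, θb > 0`,
`u`, every flow family and all times, with `K₀ = K₁ = 1`,
`c σ²(N+1)^{1/3} τ₁h_N · E_{G_N}[fastQuarticAvg ∘ Φ_r] ≤ E_{G_N}[firstPartnerSum(look-ahead τ₁h_N) ∘ Φ_r]`
for `0 < τ₁ ≤ τ₀(σ, u, θb)`, `N ≥ N₀(τ₁)`.  Proof: invariance of `G_N` under `Φ_r` + the static floor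
(`rung0_floor_window` = H1/H2/H3, H5 for `Θ̄ > 0`, `lintegral_fastQuarticAvg_flow_le`, `rung0_arith`). [folklore] -/
theorem stub_firstPartnerFloorRung0 : ∀ (a θb : ℝ) (u : V3), 0 < a → 0 < θb → ∃ σ₀ : ℝ, 0 < σ₀ ∧ ∀ σ : ℝ, 0 < σ → σ < σ₀ → ∀ T : ℝ, 0 < T → ∀ Φ : ((N : ℕ) → HardSphereFlow (Torus.geometry (Fin 3)) (hsDiameter σ N) (N + 1)), ∃ K₀ : ℝ, 0 ≤ K₀ ∧ ∃ K₁ : ℝ, ∃ τ₀ : ℝ, 0 < τ₀ ∧ ∀ τ₁ : ℝ, 0 < τ₁ → τ₁ ≤ τ₀ → ∃ c : ℝ, 0 < c ∧ ∃ N₀ : ℕ, ∀ N : ℕ, N₀ ≤ N → ∀ r : ℝ, 0 ≤ r → r ≤ T → ENNReal.ofReal (c * (σ ^ 2 * ((N + 1 : ℕ) : ℝ) ^ ((1 : ℝ) / 3)) * (τ₁ * ((N : ℝ) + 1) ^ (-(1 / 3 : ℝ)))) * (∫⁻ z, ENNReal.ofReal (fastQuarticAvg N K₀ ((Φ N).flow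 r z)) ∂(localGibbsLaw σ (fun _ => a) (fun _ => u) (fun _ => θb) N (Φ N))) ≤ ∫⁻ z, ENNReal.ofReal (firstPartnerSum (hsDiameter σ N) (τ₁ * ((N : ℝ) + 1) ^ (-(1 / 3 : ℝ))) ((Φ N).flow r z) r (mixMark N K₀ K₁)) ∂(localGibbsLaw σ (fun _ => a) (fun _ => u) (fun _ => θb) N (Φ N)) := by
  intro a θb u ha hθ
  -- small density: `SmallDensity` and `1 − 16λ ≥ 1/2`
  obtain ⟨σ₁, hσ₁, hsmall1⟩ := exists_smallDensity uniformProfile one_pos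
  have hcont : Tendsto (fun σ : ℝ => ovDensity uniformProfile σ) (nhds 0) (nhds 0) := by
    have hc : Continuous fun σ : ℝ => ovDensity uniformProfile σ := by unfold ovDensity; fun_prop
    simpa [ovDensity] using hc.tendsto 0
  obtain ⟨σ₂, hσ₂, hσ₂prop⟩ : ∃ σ₂ > 0, ∀ σ : ℝ, |σ| < σ₂ → ovDensity uniformProfile σ < 1 / 32 := by
    rcases Metric.eventually_nhds_iff.1 (hcont (Iio_mem_nhds (by norm_num : (0 : ℝ) < 1 / 32))) with ⟨δ, hδ, hδp⟩
    exact ⟨δ, hδ, fun σ hσ => hδp (by simpa [Real.dist_eq] using hσ)⟩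
  refine ⟨min σ₁ σ₂, lt_min hσ₁ hσ₂, ?_⟩
  intro σ hσ hσlt T hT Φ
  have hsd : SmallDensity uniformProfile σ := (hsmall1 σ hσ (hσlt.trans_le (min_le_left _ _))).1
  have hσ2 : σ < 1 / 2 := hsd.σ_lt_half
  obtain ⟨lam, hlamdef⟩ : ∃ lam : ℝ, lam = 1 - 16 * ovDensity uniformProfile σ := ⟨_, rfl⟩
  have hlam0 : 0 < lam := by
    have := hσ₂prop σ (by rw [abs_of_pos hσ]; exact hσlt.trans_le (min_le_right _ _))
    rw [hlamdef]; linarith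
  -- the constants: `Θ̄ > 0` (H5), `Q`, `τ₀`, and (given `τ₁`) `c`, `κ = τ₁/σ`, `N₀`
  obtain ⟨Θ, hΘdef⟩ : ∃ Θ : ℝ, Θ = ∫ p : V3 × V3, sphereMark (fun q : V3 × V3 × V3 =>
      if 1 < ‖q.2.1‖ ∧ ‖q.2.1‖ ≤ 3 ∧ ‖q.2.2‖ ≤ 1 then
        2 * (‖(reflectVel q.1 (q.2.1, q.2.2)).1‖ ^ 2 * ‖(reflectVel q.1 (q.2.1, q.2.2)).2‖ ^ 2) else 0) p.1 p.2 *
      (localMaxwellian 1 θb u p.1 * localMaxwellian 1 θb u p.2) := ⟨_, rfl⟩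
  have hΘ : 0 < Θ := by rw [hΘdef]; exact firstPartnerRung0_markPositive θb u hθ
  have hK : 0 ≤ ∫ w, ‖w‖ ^ 4 ∂ProbabilityTheory.stdGaussian V3 := integral_nonneg fun w => by positivity
  obtain ⟨Q, hQdef, hQ0⟩ : ∃ Q : ℝ, Q = 8 * ‖u‖ ^ 4 + 8 * θb ^ 2 * ∫ w, ‖w‖ ^ 4 ∂ProbabilityTheory.stdGaussian V3 ∧
      0 ≤ Q := ⟨_, rfl, by positivity⟩
  obtain ⟨τ₀, hτ₀def⟩ : ∃ τ₀ : ℝ, τ₀ = lam * Θ / (4 * (204800 * σ ^ 2 * (‖u‖ ^ 2 + 3 * θb) + 1)) := ⟨_, rfl⟩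
  have hτ₀ : 0 < τ₀ := by rw [hτ₀def]; positivity
  refine ⟨1, zero_le_one, 1, τ₀, hτ₀, ?_⟩
  intro τ₁ hτ₁ hτ₁le
  obtain ⟨c, hcdef⟩ : ∃ c : ℝ, c = lam * Θ / (4 * (Q + 1)) := ⟨_, rfl⟩
  have hc : 0 < c := by rw [hcdef]; positivity
  obtain ⟨κ, hκdef⟩ : ∃ κ : ℝ, κ = τ₁ / σ := ⟨_, rfl⟩
  have hκ : 0 < κ := by rw [hκdef]; positivity
  obtain ⟨N₁, hN₁⟩ := exists_hsDiameter_lt σ (δ := 1 / (2 * (1 + 10 * κ))) (by positivity)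
  refine ⟨c, hc, max 1 N₁, ?_⟩
  intro N hN r hr hrT
  have hN1 : (1 : ℝ) ≤ N := by exact_mod_cast (le_max_left _ _).trans hN
  have hchart : hsDiameter σ N * (1 + 10 * κ) < 1 / 2 := chart_of_lt hκ (hN₁ N ((le_max_right _ _).trans hN))
  have hκε : κ * hsDiameter σ N = τ₁ * ((N : ℝ) + 1) ^ (-(1 / 3 : ℝ)) := by
    rw [hκdef]; exact div_mul_hsDiameter hσ.ne' τ₁ N
  -- the floor (H1/H2/H3 + invariance), the quartic side, the arithmetic, the cancellation
  have hA := rung0_floor_window hσ hsd ha hθ u N (Φ N) r hκ hκε hchart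
  rw [← hΘdef, ← hlamdef] at hA
  have hY := lintegral_fastQuarticAvg_flow_le hσ2.le ha hθ u N (Φ N) 1 r
  rw [← hQdef] at hY
  obtain ⟨hB0, hE0, hreal⟩ := rung0_arith (ε := hsDiameter σ N) u hθ hσ hτ₁ hN1 (succ_mul_hsDiameter_pow_three σ N)
    hκdef hlam0 hΘ hQ0 hcdef hτ₀def hτ₁le
  have hfinal := ofReal_le_of_floor (Nat.succ_ne_zero N) hB0 hE0 hA hreal
  rw [clock_mul_lookAhead]
  calc ENNReal.ofReal (c * (σ ^ 2 * τ₁)) * ∫⁻ z, ENNReal.ofReal (fastQuarticAvg N 1 ((Φ N).flow r z))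
        ∂(localGibbsLaw σ (fun _ => a) (fun _ => u) (fun _ => θb) N (Φ N))
      ≤ ENNReal.ofReal (c * (σ ^ 2 * τ₁)) * ENNReal.ofReal Q := mul_le_mul_right hY _
    _ = ENNReal.ofReal (c * (σ ^ 2 * τ₁) * Q) := (ENNReal.ofReal_mul (by positivity)).symm
    _ ≤ _ := hfinal

end QuarticSchurLedger

end Summit.AtomisticToContinuum.HydrodynamicLimit.Theorems

end
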